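import Summits.BirchSwinnertonDyer.BirchSwinnertonDyer.Theorems.ManinLocalTwoThreeBasisSolveFortyFive
import Summits.BirchSwinnertonDyer.BirchSwinnertonDyer.Theorems.ManinLocalTwoThreeCurveExclusionFortyFive
import Summits.BirchSwinnertonDyer.BirchSwinnertonDyer.Theorems.ManinLocalTwoThreeOldFormsFortyFive
import Summits.BirchSwinnertonDyer.BirchSwinnertonDyer.Theorems.ManinLocalTwoThreeNewformPinningFiftySix
import HarnessLib

/-!
# Level 45 (C3 domain, genus 3), part 6: THE NEWFORM OF EVERY `X₀(45)`-DATUM IS `Φ₄₅ = −3B1 + 3B2 − 3B3 − 8B4 − 2B5 + B7 − B8 + B9 + 2B10`, FACT-FREE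

Cell `bsd-f2-manin`, route `ManinLocalTwoThree`, crux C3 `ManinPrimeToThreeAtNine` (stmt-BirchSwinnertonDyer-22968: `3² ∣ 45`), prover seat p2 gen 28;
`--supports` (helper).  PINNING IN `M₂`-MODE (the newform `φ₄₅` is not in the span of `η`-quotient CUSP forms): for every elliptic `W/ℚ` and every
`X₀(45)`-datum `D` of `W` (`IsNewformOf W D.f`, coefficients `aₙ(W)`), the modular form underlying `D.f` lies in `M₂(Γ₀(45)) = ⟨B1, …, B10⟩`
(`…BasisSolveFortyFive`), so its coefficients satisfy the column relations `a₁₆ = 3a₁ + 4a₄`, `a₂₀ = 5a₂ + 7a₅ − a₈`; the curve side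
(`…CurveExclusionFortyFive`: `2 ∤ 45 ⟹ 2 ∤ N_W`, `9 ∣ 45 ⟹ a₃ = 0`, `3 ∣ N_W`, Hasse at `2` — all from the datum, tree-proved) leaves the pivot vector of
`45a` or of the `3`-depleted old form `ι₁φ₁₅ + ⅓ι₃φ₁₅` (`…OldFormsFortyFive`); pivot separation identifies `D.f` with `Φ₄₅` or with that OLD form, and
`old ⊓ new = ⊥` kills the latter.  Hence **`⇑D.f = −3B1 + 3B2 − 3B3 − 8B4 − 2B5 + B7 − B8 + B9 + 2B10`** (`f_apply_eq_fortyFive`) — the input of the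
`η`-identities / Néron squeeze at level `45`.  No Hecke theory on the space, no Sturm; NO named fact.  Nothing here proves C3, Manin's conjecture or BSD.
[cite: DiamondShurman2005, Thm. 3.5.1, §5.8] [cite: AtkinLehner1970, Thm. 5] [cite: CremonaAlgorithms1997, Table 3 (N = 45)]
-/

set_option autoImplicit false
-- lint-debt: the directory name repeats the summit name (sibling precedent `ManinLocalTwoThreeNewformPinningFortyFour.lean`)
set_option linter.dupNamespace false

noncomputable section

open Complex Polynomial
open UpperHalfPlane hiding I
open scoped MatrixGroups ModularForm
open CongruenceSubgroup
open Literature.NumberTheory.ModularForms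
open Literature.NumberTheory.EllipticCurves Literature.NumberTheory.EllipticCurves.ModularForms

namespace Summit.BirchSwinnertonDyer.BirchSwinnertonDyer.Theorems.ManinLocalTwoThree.LevelFortyFive

open NewformPinningFiftySix (not_mem_old_of_isNewform0 lFunction_eq_zero_of_sq_dvd dvd_conductorNorm_iff)

variable {W : WeierstrassCurve ℚ} [W.IsElliptic]

/-! ## §1 The coefficients of `D.f`, of `Φ₄₅` and of the old witness in `M₂(Γ₀(45))` -/

omit [W.IsElliptic] in
/-- The coefficients of the modular form underlying `D.f` are the curve's `aₙ`. [folklore] -/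
theorem coeff_toModularForm_f (D : ModularParametrizationData W 45) (n : ℕ) :
    (qExpansion 1 ⇑(CuspForm.toModularFormₗ D.f)).coeff n = (W.LFunction n : ℂ) := by
  have hcoe : (⇑(CuspForm.toModularFormₗ D.f) : ℍ → ℂ) = ⇑D.f := funext (CuspForm.toModularFormₗ_apply D.f)
  rw [hcoe]
  exact D.isNewformOf.2 n

/-- The coefficients of the modular form underlying a cusp form `G` are its `cuspCoeff`s. [folklore] -/
theorem coeff_toModularForm (G : CuspForm (Gamma0 45) 2) (n : ℕ) :
    (qExpansion 1 ⇑(CuspForm.toModularFormₗ G)).coeff n = cuspCoeff G n := by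
  rw [show (⇑(CuspForm.toModularFormₗ G) : ℍ → ℂ) = ⇑G from funext (CuspForm.toModularFormₗ_apply G)]
  rfl

/-- The coordinates `(−3, 3, −3, −8, −2, 0, 1, −1, 1, 2)` of `Φ₄₅` on `(B1, …, B10)` (planner-an g51 `pinsolve 45 M2`), as a local abbreviation.
[cite: CremonaAlgorithms1997, Table 3 (N = 45)] -/
abbrev phiCoords : Fin 10 → ℂ := ![-3, 3, -3, -8, -2, 0, 1, -1, 1, 2]

/-- **The pivot coefficients of `Φ₄₅ = Σ phiCoords i • Bᵢ`**: `(a₁, a₂, a₃, a₄, a₅, a₆, a₈, a₉, a₁₀, a₁₅) = (1, 1, 0, −1, −1, 0, −3, 0, −1, 0)` — those of `45a`.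
[cite: CremonaAlgorithms1997, Table 3 (N = 45)] -/
theorem coeff_Phi45_pivots :
    (qExpansion 1 ⇑(∑ i, phiCoords i • basisForms i)).coeff 1 = (1 : ℂ) ∧
    (qExpansion 1 ⇑(∑ i, phiCoords i • basisForms i)).coeff 2 = (1 : ℂ) ∧
    (qExpansion 1 ⇑(∑ i, phiCoords i • basisForms i)).coeff 3 = (0 : ℂ) ∧
    (qExpansion 1 ⇑(∑ i, phiCoords i • basisForms i)).coeff 4 = (-1 : ℂ) ∧
    (qExpansion 1 ⇑(∑ i, phiCoords i • basisForms i)).coeff 5 = (-1 : ℂ) ∧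
    (qExpansion 1 ⇑(∑ i, phiCoords i • basisForms i)).coeff 6 = (0 : ℂ) ∧
    (qExpansion 1 ⇑(∑ i, phiCoords i • basisForms i)).coeff 8 = (-3 : ℂ) ∧
    (qExpansion 1 ⇑(∑ i, phiCoords i • basisForms i)).coeff 9 = (0 : ℂ) ∧
    (qExpansion 1 ⇑(∑ i, phiCoords i • basisForms i)).coeff 10 = (-1 : ℂ) ∧
    (qExpansion 1 ⇑(∑ i, phiCoords i • basisForms i)).coeff 15 = (0 : ℂ) := by
  refine ⟨?_, ?_, ?_, ?_, ?_, ?_, ?_, ?_, ?_, ?_⟩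
  · rw [coeff_comb_1]; simp [phiCoords]
  · rw [coeff_comb_2]; simp [phiCoords]; norm_num
  · rw [coeff_comb_3]; simp [phiCoords]; norm_num
  · rw [coeff_comb_4]; simp [phiCoords]; norm_num
  · rw [coeff_comb_5]; simp [phiCoords]; norm_num
  · rw [coeff_comb_6]; simp [phiCoords]; norm_num
  · rw [coeff_comb_8]; simp [phiCoords]; norm_num
  · rw [coeff_comb_9]; simp [phiCoords]; norm_num
  · rw [coeff_comb_10]; simp [phiCoords]; norm_num
  · rw [coeff_comb_15]; simp [phiCoords]; norm_num

/-! ## §2 The pinning -/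

/-- **THE NEWFORM OF EVERY `X₀(45)`-DATUM IS `Φ₄₅`** (as modular forms: `toModularForm D.f = Σ phiCoords i • Bᵢ`), FACT-FREE.
[cite: DiamondShurman2005, Thm. 3.5.1, §5.8] [cite: AtkinLehner1970, Thm. 5] -/
theorem toModularForm_f_eq_fortyFive (D : ModularParametrizationData W 45) :
    CuspForm.toModularFormₗ D.f = ∑ i, phiCoords i • basisForms i := by
  have hF := coeff_toModularForm_f D
  obtain ⟨r16, r20, -⟩ := columnRelations_fortyFive (CuspForm.toModularFormₗ D.f)
  rw [hF, hF, hF] at r16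
  rw [hF, hF, hF, hF] at r20
  have h16 : W.LFunction 16 = 3 * W.LFunction 1 + 4 * W.LFunction 4 := by exact_mod_cast r16
  have h20 : W.LFunction 20 = 5 * W.LFunction 2 + 7 * W.LFunction 5 - W.LFunction 8 := by exact_mod_cast r20
  have h2N : ¬ 2 ∣ W.conductorNorm ℤ := fun h ↦ absurd ((dvd_conductorNorm_iff D Nat.prime_two).mp h) (by norm_num)
  have h3N : 3 ∣ W.conductorNorm ℤ := (dvd_conductorNorm_iff D Nat.prime_three).mpr (by norm_num)
  have ha3 : W.LFunction 3 = 0 := lFunction_eq_zero_of_sq_dvd D Nat.prime_three (by norm_num)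
  obtain ⟨p1, p2, p3, p4, p5, p6, p8, p9, p10, p15⟩ := coeff_Phi45_pivots
  rcases pivotVector_fortyFive W h2N h3N ha3 h16 h20 with
    ⟨k1, k2, k3, k4, k5, k6, k8, k9, k10, k15⟩ | ⟨k1, k2, k3, k4, k5, k6, k8, k9, k10, k15⟩
  · refine eq_of_pivots_fortyFive _ _ fun n hn ↦ ?_
    simp only [Finset.mem_insert, Finset.mem_singleton] at hn
    rcases hn with rfl | rfl | rfl | rfl | rfl | rfl | rfl | rfl | rfl | rfl
    · rw [hF, p1, k1]; norm_num
    · rw [hF, p2, k2]; norm_num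
    · rw [hF, p3, k3]; norm_num
    · rw [hF, p4, k4]; norm_num
    · rw [hF, p5, k5]; norm_num
    · rw [hF, p6, k6]; norm_num
    · rw [hF, p8, k8]; norm_num
    · rw [hF, p9, k9]; norm_num
    · rw [hF, p10, k10]; norm_num
    · rw [hF, p15, k15]; norm_num
  · exfalso
    obtain ⟨G, hGold, g1, g2, g3, g4, g5, g6, g8, g9, g10, g15⟩ := oldWitness_fortyFive
    have hG := coeff_toModularForm G
    have hEq : CuspForm.toModularFormₗ D.f = CuspForm.toModularFormₗ G := by
      refine eq_of_pivots_fortyFive _ _ fun n hn ↦ ?_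
      simp only [Finset.mem_insert, Finset.mem_singleton] at hn
      rcases hn with rfl | rfl | rfl | rfl | rfl | rfl | rfl | rfl | rfl | rfl
      · rw [hF, hG, g1, k1]; norm_num
      · rw [hF, hG, g2, k2]; norm_num
      · rw [hF, hG, g3, k3]; norm_num
      · rw [hF, hG, g4, k4]; norm_num
      · rw [hF, hG, g5, k5]; norm_num
      · rw [hF, hG, g6, k6]; norm_num
      · rw [hF, hG, g8, k8]; norm_num
      · rw [hF, hG, g9, k9]; norm_num
      · rw [hF, hG, g10, k10]; norm_num
      · rw [hF, hG, g15, k15]; norm_num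
    have hfG : D.f = G := by
      have h := congrArg (fun H : ModularForm (Gamma0 45) 2 ↦ (⇑H : ℍ → ℂ)) hEq
      have hF' : (⇑(CuspForm.toModularFormₗ D.f) : ℍ → ℂ) = ⇑D.f := _root_.funext (CuspForm.toModularFormₗ_apply D.f)
      have hG' : (⇑(CuspForm.toModularFormₗ G) : ℍ → ℂ) = ⇑G := _root_.funext (CuspForm.toModularFormₗ_apply G)
      simp only [hF', hG'] at h
      exact DFunLike.coe_injective h
    exact not_mem_old_of_isNewform0 D.isNewformOf.1 (hfG ▸ hGold)

/-- **THE NEWFORM OF EVERY `X₀(45)`-DATUM, AS A FUNCTION: `⇑D.f = −3B1 + 3B2 − 3B3 − 8B4 − 2B5 + B7 − B8 + B9 + 2B10`** — FACT-FREE; the input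
of the `η`-identities (I1), (I2a) and of the Néron squeeze at level `45`. [cite: DiamondShurman2005, Thm. 3.5.1, §5.8] [cite: AtkinLehner1970, Thm. 5] -/
theorem f_apply_eq_fortyFive (D : ModularParametrizationData W 45) :
    ⇑D.f = fun τ ↦ -3 * B1 τ + 3 * B2 τ - 3 * B3 τ - 8 * B4 τ - 2 * B5 τ + B7 τ - B8 τ + B9 τ + 2 * B10 τ := by
  have h := congrArg (fun H : ModularForm (Gamma0 45) 2 ↦ (⇑H : ℍ → ℂ)) (toModularForm_f_eq_fortyFive D)
  have hF' : (⇑(CuspForm.toModularFormₗ D.f) : ℍ → ℂ) = ⇑D.f := _root_.funext (CuspForm.toModularFormₗ_apply D.f)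
  simp only [hF'] at h
  rw [h]
  funext τ
  have hs : ∀ (c : ℂ) (G : ModularForm (Gamma0 45) 2) (z : ℍ), (c • G) z = c * G z := fun _ _ _ ↦ rfl
  simp only [Fin.sum_univ_succ, Fin.sum_univ_zero, basisForms, phiCoords, Matrix.cons_val_zero, Matrix.cons_val_succ,
    ModularForm.add_apply, ModularForm.zero_apply, hs]
  ring

end Summit.BirchSwinnertonDyer.BirchSwinnertonDyer.Theorems.ManinLocalTwoThree.LevelFortyFive

end
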